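import Mathlib.Analysis.SpecialFunctions.Integrals.Basic
import HarnessLib

/-!
# Coefficient rigidity of window positivity, IV-a: a finite cosine sum with positive distinct
frequencies takes a negative value (pub-rhpf cand-7, gen 9; mechanism/rigidity campaign;
no RH claims)

Pure real analysis, used by `PfPersistenceCoefficientRigidityFiniteSites` to choose the carrier of
a wave packet against finitely many perturbation sites.  ALL STATEMENTS ARE PROVED (no `sorry`,
no axioms beyond Mathlib's); nothing here mentions ζ or RH; no sentence is DATA.

* `exists_trigSum_neg` — if `x_i > 0` are pairwise distinct on a finite index set `E` and the real
  coefficients `c_i` are not all zero, then `P(t) = ∑_{i ∈ E} c_i cos(t x_i) < 0` for some `t`.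
  Proof (Fejér-type average): with `i₁` such that `c_{i₁} ≠ 0` and `s = c_{i₁}/|c_{i₁}|`,
  `∫₀ᵀ P(t)(1 - s cos(t x_{i₁})) dt = -|c_{i₁}| T/2 + O(1)`, while the integrand would be `≥ 0`
  if `P ≥ 0`.
* `exists_Icc_trigSum_le` — hence `P ≤ -δ < 0` on a whole interval `[a, b]`, `a < b`.

References: folklore (mean values of almost periodic trigonometric sums; H. Bohr 1925).
-/

set_option linter.dupNamespace false

noncomputable section

open Set MeasureTheory intervalIntegral
open scoped Real

namespace Summit.RiemannHypothesis.RiemannHypothesis.Theorems.PfPersistenceCoefficientRigidity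

/-! ## §15 Interval integrals of cosines -/

/-- `t ↦ cos(t y)` is interval integrable. [folklore] -/
theorem intervalIntegrable_cos_mul (y a b : ℝ) :
    IntervalIntegrable (fun t : ℝ ↦ Real.cos (t * y)) volume a b :=
  (Real.continuous_cos.comp (continuous_id.mul continuous_const)).intervalIntegrable _ _

/-- `∫₀ᵀ cos(t y) dt = sin(T y)/y` for `y ≠ 0`. [folklore] -/
theorem integral_cos_mul_eq {y : ℝ} (hy : y ≠ 0) (T : ℝ) :
    ∫ t in (0 : ℝ)..T, Real.cos (t * y) = Real.sin (T * y) / y := by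
  rw [intervalIntegral.integral_comp_mul_right (fun t ↦ Real.cos t) hy, integral_cos]
  simp [div_eq_inv_mul]

/-- `|∫₀ᵀ cos(t y) dt| ≤ 1/|y|` for `y ≠ 0`, uniformly in `T`. [folklore] -/
theorem abs_integral_cos_mul_le {y : ℝ} (hy : y ≠ 0) (T : ℝ) :
    |∫ t in (0 : ℝ)..T, Real.cos (t * y)| ≤ 1 / |y| := by
  rw [integral_cos_mul_eq hy, abs_div]
  exact div_le_div_of_nonneg_right (Real.abs_sin_le_one _) (abs_nonneg _)

/-- `∫₀ᵀ cos(t·0) dt = T`. [folklore] -/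
theorem integral_cos_mul_zero (T : ℝ) : ∫ t in (0 : ℝ)..T, Real.cos (t * 0) = T := by simp

/-- One term of `P(t)(1 - s cos(t x₁))`, integrated (product-to-sum). [folklore] -/
theorem integral_term_eq (ci s xi x1 T : ℝ) :
    ∫ t in (0 : ℝ)..T, ci * Real.cos (t * xi) * (1 - s * Real.cos (t * x1)) =
      ci * (∫ t in (0 : ℝ)..T, Real.cos (t * xi)) -
        s * ci * ((∫ t in (0 : ℝ)..T, Real.cos (t * (xi - x1))) / 2 +
          (∫ t in (0 : ℝ)..T, Real.cos (t * (xi + x1))) / 2) := by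
  have hpt : ∀ t : ℝ, ci * Real.cos (t * xi) * (1 - s * Real.cos (t * x1)) =
      ci * Real.cos (t * xi) -
        s * ci * (Real.cos (t * (xi - x1)) / 2 + Real.cos (t * (xi + x1)) / 2) := by
    intro t
    rw [mul_sub t xi x1, mul_add t xi x1, Real.cos_sub, Real.cos_add]
    ring
  simp_rw [hpt]
  have hA : IntervalIntegrable (fun t : ℝ ↦ ci * Real.cos (t * xi)) volume 0 T :=
    (intervalIntegrable_cos_mul xi 0 T).const_mul ci
  have hB1 : IntervalIntegrable (fun t : ℝ ↦ Real.cos (t * (xi - x1)) / 2) volume 0 T :=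
    (intervalIntegrable_cos_mul _ 0 T).div_const 2
  have hB2 : IntervalIntegrable (fun t : ℝ ↦ Real.cos (t * (xi + x1)) / 2) volume 0 T :=
    (intervalIntegrable_cos_mul _ 0 T).div_const 2
  have hB : IntervalIntegrable
      (fun t : ℝ ↦ s * ci * (Real.cos (t * (xi - x1)) / 2 + Real.cos (t * (xi + x1)) / 2))
      volume 0 T := (hB1.add hB2).const_mul (s * ci)
  rw [intervalIntegral.integral_sub hA hB, intervalIntegral.integral_const_mul,
    intervalIntegral.integral_const_mul, intervalIntegral.integral_add hB1 hB2,
    intervalIntegral.integral_div, intervalIntegral.integral_div]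

/-- Bound for a term with a frequency `xi ≠ x1` (both positive, `|s| = 1`):
`≤ |ci|/xi + |ci|(1/|xi - x1| + 1/(xi + x1))/2`, uniformly in `T`. [folklore] -/
theorem integral_term_le_of_ne {ci s xi x1 : ℝ} (hs : |s| = 1) (hxi : 0 < xi) (hx1 : 0 < x1)
    (hne : xi ≠ x1) (T : ℝ) :
    ∫ t in (0 : ℝ)..T, ci * Real.cos (t * xi) * (1 - s * Real.cos (t * x1)) ≤
      |ci| / xi + |ci| * ((1 / |xi - x1| + 1 / (xi + x1)) / 2) := by
  rw [integral_term_eq]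
  set A := ∫ t in (0 : ℝ)..T, Real.cos (t * xi) with hAdef
  set B := ∫ t in (0 : ℝ)..T, Real.cos (t * (xi - x1)) with hBdef
  set C := ∫ t in (0 : ℝ)..T, Real.cos (t * (xi + x1)) with hCdef
  have h1 : |ci * A| ≤ |ci| / xi := by
    rw [abs_mul]
    calc |ci| * |A| ≤ |ci| * (1 / |xi|) :=
          mul_le_mul_of_nonneg_left (abs_integral_cos_mul_le hxi.ne' T) (abs_nonneg _)
      _ = |ci| / xi := by rw [abs_of_pos hxi]; ring
  have h2 : |s * ci * (B / 2 + C / 2)| ≤ |ci| * ((1 / |xi - x1| + 1 / (xi + x1)) / 2) := by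
    rw [abs_mul, abs_mul, hs, one_mul]
    refine mul_le_mul_of_nonneg_left ?_ (abs_nonneg _)
    have hB := abs_integral_cos_mul_le (sub_ne_zero.2 hne) T
    have hC := abs_integral_cos_mul_le (show xi + x1 ≠ 0 by positivity) T
    rw [abs_of_pos (by positivity : 0 < xi + x1)] at hC
    calc |B / 2 + C / 2| ≤ |B / 2| + |C / 2| := abs_add_le _ _
      _ = |B| / 2 + |C| / 2 := by rw [abs_div, abs_div, abs_two]
      _ ≤ (1 / |xi - x1|) / 2 + (1 / (xi + x1)) / 2 := by gcongr
      _ = (1 / |xi - x1| + 1 / (xi + x1)) / 2 := by ring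
  linarith [le_abs_self (ci * A), neg_abs_le (s * ci * (B / 2 + C / 2))]

/-- Bound for the resonant term (`xi = x1 > 0`, `s c1 = |c1|`): it is `≤ O(1) - |c1| T/2`.
[folklore] -/
theorem integral_term_self_le {c1 s x1 : ℝ} (hsc : s * c1 = |c1|) (hx1 : 0 < x1) (T : ℝ) :
    ∫ t in (0 : ℝ)..T, c1 * Real.cos (t * x1) * (1 - s * Real.cos (t * x1)) ≤
      |c1| / x1 + |c1| / (4 * x1) - |c1| * T / 2 := by
  rw [integral_term_eq, sub_self, hsc, integral_cos_mul_zero]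
  set A := ∫ t in (0 : ℝ)..T, Real.cos (t * x1) with hAdef
  set C := ∫ t in (0 : ℝ)..T, Real.cos (t * (x1 + x1)) with hCdef
  have h1 : |c1 * A| ≤ |c1| / x1 := by
    rw [abs_mul]
    calc |c1| * |A| ≤ |c1| * (1 / |x1|) :=
          mul_le_mul_of_nonneg_left (abs_integral_cos_mul_le hx1.ne' T) (abs_nonneg _)
      _ = |c1| / x1 := by rw [abs_of_pos hx1]; ring
  have h2 : |C| ≤ 1 / (2 * x1) := by
    have := abs_integral_cos_mul_le (show x1 + x1 ≠ 0 by positivity) T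
    rw [abs_of_pos (by positivity : 0 < x1 + x1)] at this
    rw [two_mul]
    exact this
  have h3 : -(|c1| * (C / 2)) ≤ |c1| / (4 * x1) := by
    have h4 : |c1| * |C| ≤ |c1| * (1 / (2 * x1)) := mul_le_mul_of_nonneg_left h2 (abs_nonneg _)
    have e : |c1| * (1 / (2 * x1)) = 2 * (|c1| / (4 * x1)) := by
      field_simp
      ring
    nlinarith [neg_abs_le C, abs_nonneg c1]
  nlinarith [le_abs_self (c1 * A), h1, h3]

/-! ## §16 A cosine sum with positive distinct frequencies goes negative -/

/-- **A finite cosine sum `P(t) = ∑ c_i cos(t x_i)` with pairwise distinct positive frequencies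
and some `c_i ≠ 0` takes a negative value.**  (Otherwise `0 ≤ ∫₀ᵀ P(t)(1 - s cos(t x_{i₁})) dt
= -|c_{i₁}|T/2 + O(1)`, `s = c_{i₁}/|c_{i₁}|`.) [folklore] -/
theorem exists_trigSum_neg {ι : Type*} {E : Finset ι} {c x : ι → ℝ}
    (hx : ∀ i ∈ E, 0 < x i) (hinj : Set.InjOn x E) (hc : ∃ i ∈ E, c i ≠ 0) :
    ∃ t : ℝ, ∑ i ∈ E, c i * Real.cos (t * x i) < 0 := by
  classical
  obtain ⟨i₁, hi₁, hc₁⟩ := hc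
  by_contra! hpos
  have hx1 : 0 < x i₁ := hx i₁ hi₁
  have hac : 0 < |c i₁| := abs_pos.2 hc₁
  set s : ℝ := c i₁ / |c i₁| with hsdef
  have hsc : s * c i₁ = |c i₁| := by
    rw [hsdef, div_mul_eq_mul_div, ← abs_mul_abs_self (c i₁)]
    exact mul_div_cancel_right₀ _ hac.ne'
  have hs1 : |s| = 1 := by rw [hsdef, abs_div, abs_abs, div_self hac.ne']
  -- the `O(1)` constant
  set B₀ : ℝ := |c i₁| / x i₁ + |c i₁| / (4 * x i₁) +
      ∑ i ∈ E.erase i₁, (|c i| / x i + |c i| * ((1 / |x i - x i₁| + 1 / (x i + x i₁)) / 2))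
    with hB₀
  have hb0 : 0 ≤ ∑ i ∈ E.erase i₁,
      (|c i| / x i + |c i| * ((1 / |x i - x i₁| + 1 / (x i + x i₁)) / 2)) :=
    Finset.sum_nonneg fun i hi ↦ by
      have := hx i (Finset.mem_of_mem_erase hi)
      positivity
  have hB₀0 : 0 ≤ B₀ := add_nonneg (by positivity) hb0
  set T : ℝ := 2 * (B₀ + 1) / |c i₁| with hTdef
  have hT0 : 0 ≤ T := by positivity
  have hcT : |c i₁| * T / 2 = B₀ + 1 := by
    rw [hTdef]
    field_simp
  -- the weight `1 - s cos(t x₁)` is non-negative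
  have hw : ∀ t : ℝ, 0 ≤ 1 - s * Real.cos (t * x i₁) := fun t ↦ by
    have h : s * Real.cos (t * x i₁) ≤ 1 := by
      calc s * Real.cos (t * x i₁) ≤ |s * Real.cos (t * x i₁)| := le_abs_self _
        _ = |s| * |Real.cos (t * x i₁)| := abs_mul _ _
        _ ≤ 1 * 1 := by
            rw [hs1]
            exact mul_le_mul_of_nonneg_left (Real.abs_cos_le_one _) zero_le_one
        _ = 1 := one_mul 1
    linarith
  have hI : 0 ≤ ∫ t in (0 : ℝ)..T,
      (∑ i ∈ E, c i * Real.cos (t * x i)) * (1 - s * Real.cos (t * x i₁)) :=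
    intervalIntegral.integral_nonneg hT0 fun t _ ↦ mul_nonneg (hpos t) (hw t)
  have hint : ∀ i ∈ E, IntervalIntegrable
      (fun t : ℝ ↦ c i * Real.cos (t * x i) * (1 - s * Real.cos (t * x i₁))) volume 0 T :=
    fun i _ ↦ (by fun_prop : Continuous fun t : ℝ ↦
      c i * Real.cos (t * x i) * (1 - s * Real.cos (t * x i₁))).intervalIntegrable _ _
  have hsplit : ∫ t in (0 : ℝ)..T,
      (∑ i ∈ E, c i * Real.cos (t * x i)) * (1 - s * Real.cos (t * x i₁)) =
        ∑ i ∈ E, ∫ t in (0 : ℝ)..T, c i * Real.cos (t * x i) * (1 - s * Real.cos (t * x i₁)) := by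
    simp_rw [Finset.sum_mul]
    exact intervalIntegral.integral_finsetSum hint
  have hle : ∑ i ∈ E, ∫ t in (0 : ℝ)..T,
      c i * Real.cos (t * x i) * (1 - s * Real.cos (t * x i₁)) ≤ B₀ - |c i₁| * T / 2 := by
    rw [← Finset.add_sum_erase E _ hi₁]
    have h1 := integral_term_self_le hsc hx1 T
    have h2 : ∑ i ∈ E.erase i₁, ∫ t in (0 : ℝ)..T,
        c i * Real.cos (t * x i) * (1 - s * Real.cos (t * x i₁)) ≤
          ∑ i ∈ E.erase i₁,
            (|c i| / x i + |c i| * ((1 / |x i - x i₁| + 1 / (x i + x i₁)) / 2)) :=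
      Finset.sum_le_sum fun i hi ↦ by
        have hiE := Finset.mem_of_mem_erase hi
        have hne : x i ≠ x i₁ := fun h ↦ (Finset.ne_of_mem_erase hi) (hinj hiE hi₁ h)
        exact integral_term_le_of_ne hs1 (hx i hiE) hx1 hne T
    rw [hB₀]
    linarith
  rw [hsplit] at hI
  linarith

/-- **Negative on an interval**: under the same hypotheses there are `a < b` and `δ > 0` with
`∑ c_i cos(t x_i) ≤ -δ` for all `t ∈ [a, b]` (continuity). [folklore] -/
theorem exists_Icc_trigSum_le {ι : Type*} {E : Finset ι} {c x : ι → ℝ}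
    (hx : ∀ i ∈ E, 0 < x i) (hinj : Set.InjOn x E) (hc : ∃ i ∈ E, c i ≠ 0) :
    ∃ a b δ : ℝ, a < b ∧ 0 < δ ∧
      ∀ t ∈ Icc a b, ∑ i ∈ E, c i * Real.cos (t * x i) ≤ -δ := by
  obtain ⟨t₀, ht₀⟩ := exists_trigSum_neg hx hinj hc
  set P : ℝ → ℝ := fun t ↦ ∑ i ∈ E, c i * Real.cos (t * x i) with hP
  have hcont : Continuous P := by
    rw [hP]
    fun_prop
  have hP0 : P t₀ < 0 := ht₀
  have hδ : 0 < -(P t₀) / 2 := by linarith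
  obtain ⟨ε, hε, hball⟩ := Metric.continuous_iff.1 hcont t₀ (-(P t₀) / 2) hδ
  refine ⟨t₀ - ε / 2, t₀ + ε / 2, -(P t₀) / 2, by linarith, hδ, fun t ht ↦ ?_⟩
  have hd : dist t t₀ < ε := by
    rw [mem_Icc] at ht
    rw [Real.dist_eq, abs_lt]
    constructor <;> linarith
  have h := hball t hd
  rw [Real.dist_eq, abs_lt] at h
  show P t ≤ -(-(P t₀) / 2)
  linarith [h.2]

end Summit.RiemannHypothesis.RiemannHypothesis.Theorems.PfPersistenceCoefficientRigidity

end
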